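import Mathlib
import Summits.Ventures.HodgeRepro.Tier4.Common.KTypeSpace
import Summits.Ventures.HodgeRepro.Tier4.Common.SettingOfData
import Summits.Ventures.HodgeRepro.Tier4.Line1.SpectralOfRTF
import Summits.Ventures.HodgeRepro.Tier4.Line1.IrreducibleSubspace
import Summits.Ventures.HodgeRepro.Tier4.Line1.KernelNondegenerate
import Summits.Ventures.HodgeRepro.Tier4.Line1.LocallyCompactGA
import Summits.Ventures.HodgeRepro.Tier4.Line1.SecondCountableGA
import Summits.Ventures.HodgeRepro.Tier4.Line1.L2InfiniteGA
import Summits.Ventures.HodgeRepro.Tier4.Line1.MaximalFamily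
import Summits.Ventures.HodgeRepro.Tier4.Line4.W4SpectralBridge
import Summits.Ventures.HodgeRepro.Tier4.Line4.W3Reduction
import Summits.Ventures.HodgeRepro.Tier4.Line4.W3Reduction2
import Summits.Ventures.HodgeRepro.Tier4.Line4.RieszOnSetting
import Summits.Ventures.HodgeRepro.Tier4.Line4.W3ReductionGeneric
import Summits.Ventures.HodgeRepro.Tier4.Line4.W3OfAdaptedGeneric
import Summits.Ventures.HodgeRepro.Tier4.Line4.KTypeTransport
import Summits.Ventures.HodgeRepro.Tier4.Line4.KTypeTransportGeneric

/-!
# Tier4/Line4/W3OfRieszType — the L4 wall's reduction chain on the REPAIRED Riesz space `Common.kTypeSpace'` (typer-2 v0.2,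
plan-4's `T′` choice S13808: the `T′`-weight `K`-fixed vectors): the W3‴ → L4.3b′ glue, the reduction, the basis-free residual and
the `(τ′,K)`-transport, all by name from the clause-agnostic modules

Blind re-derivation cell `pub-hodge-repro`, Tier 4 «prove the step» (README §9–§10), seat t4-L4-p1 (prover, LINE L4,
gen 3; O-L4-JOINT S13773, the planner's choice S13808).  Tree path
`lean/Summits/Ventures/HodgeRepro/Tier4/Line4/W3OfRieszType.lean`.

WHAT IS PROVED (every statement is the landed one with the joint `kTypeSpace` replaced by `kTypeSpace'`):
* `exists_spectrum_of_rungsS'` — the glue from the re-typed wall W3‴ (`∃ V admissible, ∃ K, FiniteDimensional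
  (kTypeSpace' … K V) ∧ ∃ f, IsRieszVectorOn R μ DG (kTypeSpace' … K V) f ∧ P_χ(f) ≠ 0`) to L4.3b′'s conclusion
  (`mixed_two_torus`'s, byte-unchanged): only `kTypeSpace'_le` is used (t4-L4-p1 g2's `exists_spectrum_of_rungsS`);
* `mixed_two_torus_W3R_of_spectral_data` — L1-p5's repaired reduction at `Sp := kTypeSpace'` (`W3ReductionGeneric`);
* `mixed_two_torus_W3R_of_adapted` — the basis-free six-clause residual at `Sp := kTypeSpace'` (`W3OfAdaptedGeneric`);
* `rightRegular_mem_kTypeSpace'` — `R(f)` of a left-`(τ′,K)`-equivariant test function (equivariant under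
  `localTorusAt' W w` at every infinite place and left-invariant under `K` — NO `T`-clause) lands in `kTypeSpace'`;
* `exists_scalar_conj_of_le_span_singleton_riesz` — one scalar on a one-dimensional `kTypeSpace'`, on the conjugates.
Nothing of the wall's content is proved; the residual's clauses are now on an object with genuine two-torus instances.

Nothing here says anything about the status of the Hodge conjecture for CM abelian varieties, which is NOT proved
(HC_CM is NOT proved by anyone in this repository).
-/

set_option autoImplicit false

noncomputable section

namespace Summit.Ventures.HodgeRepro.Tier4.Line4

open Summit.Ventures.HodgeRepro.Tier4.Common Summit.Ventures.HodgeRepro.Tier4.Line1 MeasureTheory NumberField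
open scoped ComplexConjugate

section Riesz

variable {k : Type} [Field k] [NumberField k] (W : PlaneData k) [MeasurableSpace (GA W)] [BorelSpace (GA W)]
  (R : RTFData W) (μ : Measure (GA W)) [μ.IsHaarMeasure] [R.μT.IsHaarMeasure] [R.μT'.IsHaarMeasure]
  (DG : Set (GA W)) (fdG : IsFundamentalDomain (rationalPoints W) DG μ) (compG : IsCompact (closure DG))
  (compT : IsCompact (closure R.DT)) (compT' : IsCompact (closure R.DT'))

/-- **The W3‴ → L4.3b′ glue on the repaired space**: from an admissible `V`, a level `K` with finite-dimensional
`kTypeSpace' … K V` and a Riesz vector of `P_{χ′}` on it with non-zero `T`-period, the conclusion of `mixed_two_torus`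
(an admissible `V` with non-zero `T′`-period and a non-zero `f ∈ V` with non-zero `T`-period). -/
theorem exists_spectrum_of_rungsS' (q : QuadData k) (g g' : Matrix (Fin 4) (Fin 4) k) (w₀ : InfinitePlace k)
    (eP eM eP' eM' : InfinitePlace k → ℤ)
    (h3 : ∃ V : Submodule ℂ (GA W → ℂ),
      IsAdmissibleS W (Setting.ofAdelicData W R μ DG fdG compG compT compT') q g g' w₀ eP eM eP' eM' V ∧
      ∃ K : Subgroup (GA W), IsCompactOpenIn W (finitePart W) K ∧
        FiniteDimensional ℂ (kTypeSpace' W q g g' eP' eM' K V) ∧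
        ∃ f, IsRieszVectorOn R μ DG (kTypeSpace' W q g g' eP' eM' K V) f ∧
          periodLin W R.μT R.DT R.chi (restrictTo W (torusT W) f) ≠ 0) :
    ∃ V : Submodule ℂ (GA W → ℂ),
      IsAdmissibleS W (Setting.ofAdelicData W R μ DG fdG compG compT compT') q g g' w₀ eP eM eP' eM' V ∧
      HasNonzeroToricPeriod W R.μT' R.DT' R.chi' V ∧
      ∃ f ∈ V, f ≠ 0 ∧ periodLin W R.μT R.DT R.chi (restrictTo W (torusT W) f) ≠ 0 := by
  obtain ⟨V, hadm, K, _, _, f, hf, hmixed⟩ := h3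
  have hle : kTypeSpace' W q g g' eP' eM' K V ≤ V := kTypeSpace'_le W q g g' eP' eM' K V
  exact ⟨V, hadm, hasNonzeroToricPeriod_of_rieszOn_setting W R μ DG fdG compG compT compT' hadm.1 hle hf,
    f, hle hf.1, hf.2.1, hmixed⟩

/-- L1-p5's repaired reduction at the `T′`-Riesz space `kTypeSpace'`. -/
theorem mixed_two_torus_W3R_of_spectral_data (hc : Continuous R.chi) (hu : ∀ a, ‖R.chi a‖ = 1)
    (hc' : Continuous R.chi') (hunit' : ∀ t, ‖R.chi' t‖ = 1)
    (q : QuadData k) (g g' : Matrix (Fin 4) (Fin 4) k) (w₀ : InfinitePlace k)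
    (eP eM eP' eM' : InfinitePlace k → ℤ) (V : ℕ → Submodule ℂ (GA W → ℂ))
    (K : Subgroup (GA W)) (hK : IsCompactOpenIn W (finitePart W) K)
    {τ : ℕ → Set (GA W → ℂ)} {φ : ℕ → GA W → ℂ} {n : ℕ → ℕ}
    (hB : (Setting.ofAdelicData W R μ DG fdG compG compT compT').IsAdaptedONB τ φ n)
    (F : ℕ → Finset ℕ) (hF : ∀ m, ∀ j ∈ F m, n j = m)
    (hspan : ∀ m, Submodule.span ℂ ((fun j => fun x => conj (φ j x)) '' (F m : Set ℕ)) =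
      kTypeSpace' W q g g' eP' eM' K (V m))
    {f₁ f₂ : GA W → ℂ} (h₁ : IsTestFn W f₁) (h₂ : IsTestFn W f₂) (a b : ℕ → ℂ)
    (hadm : ∀ m, a m ≠ 0 →
      IsAdmissibleS W (Setting.ofAdelicData W R μ DG fdG compG compT compT') q g g' w₀ eP eM eP' eM' (V m))
    (ha : ∀ m, ∀ j ∈ F m, rightRegular W μ (RTF.cj f₁) (φ j) = fun x => a m * φ j x)
    (hb : ∀ m, ∀ j ∈ F m, rightRegular W μ (RTF.refl f₂) (φ j) = fun x => b m * φ j x)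
    (hvan' : ∀ j, j ∉ F (n j) → rightRegular W μ (RTF.cj f₁) (φ j) = fun _ => 0)
    (hJ : R.Jc ((Setting.ofAdelicData W R μ DG fdG compG compT compT').conv f₁ f₂) ≠ 0) :
    ∃ V₀ : Submodule ℂ (GA W → ℂ),
      IsAdmissibleS W (Setting.ofAdelicData W R μ DG fdG compG compT compT') q g g' w₀ eP eM eP' eM' V₀ ∧
      ∃ K₀ : Subgroup (GA W), IsCompactOpenIn W (finitePart W) K₀ ∧
        FiniteDimensional ℂ (kTypeSpace' W q g g' eP' eM' K₀ V₀) ∧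
        ∃ f : GA W → ℂ, IsRieszVectorOn R μ DG (kTypeSpace' W q g g' eP' eM' K₀ V₀) f ∧
          periodLin W R.μT R.DT R.chi (restrictTo W (torusT W) f) ≠ 0 :=
  mixed_two_torus_W3_of_spectral_data_generic W R μ DG fdG compG compT compT' (fun K V => kTypeSpace' W q g g' eP' eM' K V)
    hc hu hc' hunit' q g g' w₀ eP eM eP' eM' V K hK hB F hF hspan h₁ h₂ a b hadm ha hb hvan' hJ

/-- **The basis-free residual on the repaired space**: W3‴'s conclusion from the six per-constituent clauses on
`kTypeSpace'` (finiteness on the non-zero irreducible constituents, one scalar of `R(f̄₁)` / `R(f₂ˇ)` on the conjugate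
`T′`-Riesz space of each, within-constituent vanishing, admissibility of the hit constituents, `Jc(f₁ ⋆ f₂) ≠ 0`). -/
theorem mixed_two_torus_W3R_of_adapted (hc : Continuous R.chi) (hu : ∀ a, ‖R.chi a‖ = 1)
    (hc' : Continuous R.chi') (hunit' : ∀ t, ‖R.chi' t‖ = 1)
    (q : QuadData k) (g g' : Matrix (Fin 4) (Fin 4) k) (w₀ : InfinitePlace k)
    (eP eM eP' eM' : InfinitePlace k → ℤ)
    (K : Subgroup (GA W)) (hK : IsCompactOpenIn W (finitePart W) K)
    (hfin : ∀ U : Set (GA W → ℂ), (Setting.ofAdelicData W R μ DG fdG compG compT compT').IsIrrNonzero U →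
      FiniteDimensional ℂ (kTypeSpace' W q g g' eP' eM' K (Submodule.span ℂ U)))
    {f₁ f₂ : GA W → ℂ} (h₁ : IsTestFn W f₁) (h₂ : IsTestFn W f₂)
    (ha : ∀ U : Set (GA W → ℂ), (Setting.ofAdelicData W R μ DG fdG compG compT compT').IsIrrNonzero U →
      ∃ a : ℂ, ∀ ψ ∈ kTypeSpace' W q g g' eP' eM' K (Submodule.span ℂ U),
        rightRegular W μ (RTF.cj f₁) (fun x => conj (ψ x)) = fun x => a * conj (ψ x))
    (hb : ∀ U : Set (GA W → ℂ), (Setting.ofAdelicData W R μ DG fdG compG compT compT').IsIrrNonzero U →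
      ∃ b : ℂ, ∀ ψ ∈ kTypeSpace' W q g g' eP' eM' K (Submodule.span ℂ U),
        rightRegular W μ (RTF.refl f₂) (fun x => conj (ψ x)) = fun x => b * conj (ψ x))
    (hvan : ∀ U : Set (GA W → ℂ), (Setting.ofAdelicData W R μ DG fdG compG compT compT').IsIrrNonzero U →
      ∀ ψ ∈ U, (∀ w ∈ kTypeSpace' W q g g' eP' eM' K (Submodule.span ℂ U),
        (Setting.ofAdelicData W R μ DG fdG compG compT compT').inner ψ w = 0) →
        rightRegular W μ (RTF.cj f₁) (fun x => conj (ψ x)) = fun _ => 0)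
    (hadm : ∀ U : Set (GA W → ℂ), (Setting.ofAdelicData W R μ DG fdG compG compT compT').IsIrrNonzero U →
      ∀ a : ℂ, a ≠ 0 →
      (∃ ψ ∈ kTypeSpace' W q g g' eP' eM' K (Submodule.span ℂ U), ψ ≠ 0 ∧
        rightRegular W μ (RTF.cj f₁) (fun x => conj (ψ x)) = fun x => a * conj (ψ x)) →
      IsAdmissibleS W (Setting.ofAdelicData W R μ DG fdG compG compT compT') q g g' w₀ eP eM eP' eM'
        (Submodule.span ℂ U))
    (hJ : R.Jc ((Setting.ofAdelicData W R μ DG fdG compG compT compT').conv f₁ f₂) ≠ 0) :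
    ∃ V₀ : Submodule ℂ (GA W → ℂ),
      IsAdmissibleS W (Setting.ofAdelicData W R μ DG fdG compG compT compT') q g g' w₀ eP eM eP' eM' V₀ ∧
      ∃ K₀ : Subgroup (GA W), IsCompactOpenIn W (finitePart W) K₀ ∧
        FiniteDimensional ℂ (kTypeSpace' W q g g' eP' eM' K₀ V₀) ∧
        ∃ f : GA W → ℂ, IsRieszVectorOn R μ DG (kTypeSpace' W q g g' eP' eM' K₀ V₀) f ∧
          periodLin W R.μT R.DT R.chi (restrictTo W (torusT W) f) ≠ 0 :=
  mixed_two_torus_W3_of_adapted_generic W R μ DG fdG compG compT compT' (fun K V => kTypeSpace' W q g g' eP' eM' K V)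
    (fun K V => kTypeSpace'_le W q g g' eP' eM' K V) hc hu hc' hunit' q g g' w₀ eP eM eP' eM' K hK hfin h₁ h₂
    ha hb hvan hadm hJ

/-- **`R(f)` of a left-`(τ′,K)`-equivariant test function lands in `kTypeSpace'`** (no `T`-clause). -/
theorem rightRegular_mem_kTypeSpace' (q : QuadData k) (g g' : Matrix (Fin 4) (Fin 4) k)
    (eP' eM' : InfinitePlace k → ℤ) (K : Subgroup (GA W)) (V : Submodule ℂ (GA W → ℂ))
    (hV : (Setting.ofAdelicData W R μ DG fdG compG compT compT').IsInvariantSubspace (V : Set (GA W → ℂ)))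
    {f : GA W → ℂ} (hf : IsTestFn W f)
    (hfT' : ∀ (w : InfinitePlace k) (κ : GA W), κ ∈ localTorusAt' W w → ∀ y,
      f (κ⁻¹ * y) = weightAt' W q w g g' 0 κ ^ eP' w * weightAt' W q w g g' 1 κ ^ eM' w * f y)
    (hfK : ∀ κ ∈ K, ∀ y, f (κ⁻¹ * y) = f y)
    {φ : GA W → ℂ} (hφ : φ ∈ V) :
    rightRegular W μ f φ ∈ kTypeSpace' W q g g' eP' eM' K V := by
  refine ⟨hV.conv φ hφ f ⟨hf.1, hf.2⟩, fun w x κ hκ => ?_, fun x κ hκ => ?_⟩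
  · exact rightRegular_apply_mul_of_left_equivariant W μ f φ x κ _ (hfT' w κ hκ)
  · have := rightRegular_apply_mul_of_left_equivariant W μ f φ x κ 1 (fun y => by rw [hfK κ hκ y, one_mul])
    rw [this, one_mul]

/-- **One scalar on a one-dimensional `kTypeSpace'`, on the conjugates** (the clauses `ha`/`hb` of
`mixed_two_torus_W3R_of_adapted` from multiplicity one + left-`(τ′,K)`-equivariance). -/
theorem exists_scalar_conj_of_le_span_singleton_riesz (q : QuadData k) (g g' : Matrix (Fin 4) (Fin 4) k)
    (eP' eM' : InfinitePlace k → ℤ) (K : Subgroup (GA W)) (V : Submodule ℂ (GA W → ℂ))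
    (hV : (Setting.ofAdelicData W R μ DG fdG compG compT compT').IsInvariantSubspace (V : Set (GA W → ℂ)))
    {f : GA W → ℂ} (hf : IsTestFn W f)
    (hfT' : ∀ (w : InfinitePlace k) (κ : GA W), κ ∈ localTorusAt' W w → ∀ y,
      f (κ⁻¹ * y) = weightAt' W q w g g' 0 κ ^ eP' w * weightAt' W q w g g' 1 κ ^ eM' w * f y)
    (hfK : ∀ κ ∈ K, ∀ y, f (κ⁻¹ * y) = f y)
    (hmult : ∃ v : GA W → ℂ, kTypeSpace' W q g g' eP' eM' K V ≤ Submodule.span ℂ {v}) :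
    ∃ a : ℂ, ∀ ψ ∈ kTypeSpace' W q g g' eP' eM' K V,
      rightRegular W μ (RTF.cj f) (fun x => conj (ψ x)) = fun x => a * conj (ψ x) :=
  exists_scalar_conj_of_le_span_singleton_generic W μ V (kTypeSpace' W q g g' eP' eM' K V)
    (kTypeSpace'_le W q g g' eP' eM' K V) f
    (fun _ hψ => rightRegular_mem_kTypeSpace' W R μ DG fdG compG compT compT' q g g' eP' eM' K V hV hf hfT' hfK hψ)
    hmult

end Riesz

end Summit.Ventures.HodgeRepro.Tier4.Line4

end
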